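import Mathlib
import Summits.RiemannHypothesis.RiemannHypothesis.Theorems.WeilFarCoercivityFloor
import Literature.NumberTheory.LFunctions.ChebyshevPsiExplicit
import Literature.NumberTheory.LFunctions.MertensConstant
import HarnessLib

/-!
# The far-coercivity floor from BELOW with Chebyshev's constant: the test function `cosh(x/2)·1_{[−a,a]}`

Helper file (`--supports stmt-RiemannHypothesis-0098`, lead-track anchor: Weil-positivity window ladder, format-C far bound),
RH-free, pure proofs.  Seat rh-explicit-weil-1 gen9 (memo `run/shared/lean/pub/rh-explicit/rh-explicit-weil-1/FORMAT-K3.md` §10).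
Companion of `WeilFarFloorSchur` (the floor from ABOVE: `λ_max(a) ≤ 1.106e^a + 12a² + 2a + 81`) and `WeilFarFloorGrowth`
(`0.7e^a/a − 6 ≤ λ_max(a)`); this file removes the factor `1/a` of the latter.
§1 THE TEST FUNCTION `χ_a = 1_{[−a,a]}·cosh(·/2)`: its shifted self-overlap in closed form,
`∫ χ_a(x − ℓ) χ_a(x) dx = sinh(a − ℓ/2) + (2a − ℓ)cosh(ℓ/2)/2` (`0 ≤ ℓ ≤ 2a`), `∫ χ_a² = a + sinh a`, whence the Rayleigh numerator
in CLOSED FORM on the Chebyshev side: `Q_a(χ_a) = Σ_{n ≤ e^{2a}} Λ(n)·[e^a/n − e^{−a} + (2a − log n)(1 + 1/n)/2]`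
(`primeShiftForm_coshTest`) — i.e. `e^a·M(e^{2a}) − e^{−a}ψ(e^{2a}) + ½Σ_{n≤e^{2a}} Λ(n)(1 + 1/n)(2a − log n)`.
§2 ABEL: `Σ_{n ≤ X} Λ(n) log(X/n) = ∫₁^X ψ(t) dt/t` (`sum_vonMangoldt_mul_log_div_eq_integral`), and with Chebyshev's
`ψ(n) ≥ A·n − 5 log n` (`n ≥ 30`, `A > 0.9212`, Literature `ChebyshevExplicit.psi_ge_chebyshev`):
`∫₁^X ψ(t)dt/t ≥ A·X − 30A − A log X − (5/2) log² X` (`X ≥ 30`).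
§3 THE ORDER FROM BELOW: with Mertens from below (`Σ_{p≤x} log p/p ≥ log x − 4`, Literature `MertensConstant`) and Chebyshev from
above for the one negative term: **`(9/10)·e^a − 14 ≤ λ_max(a)` for every `a ≥ 3`** (`farCoercivityFloor_ge_coshTest`).  With
`WeilFarFloorSchur`: `0.9e^a − 14 ≤ λ_max(a) ≤ 1.106e^a + 12a² + 2a + 81` — the floor of STRUCTURE.md C-XIII has exact order `e^a` with
constants `[0.90, 1.106]` by theorem (numerically this test function gives `91 % … 99.8 %` of the floor for `a = 1 … 3`).
Standard axioms only.
-/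

set_option linter.dupNamespace false
set_option autoImplicit false

noncomputable section

open MeasureTheory Set Finset intervalIntegral
open scoped Real BigOperators ArithmeticFunction.vonMangoldt Chebyshev

namespace Summit.RiemannHypothesis.RiemannHypothesis.Theorems.WeilFormatC

namespace FloorCosh

variable {a : ℝ}

/-! ## §1 The test function `χ_a = 1_{[−a,a]}·cosh(·/2)` -/

/-- `cosh(x/2)·cosh((x − ℓ)/2) = (cosh(x − ℓ/2) + cosh(ℓ/2))/2`. -/
theorem cosh_half_mul_cosh_half (x ℓ : ℝ) :
    Real.cosh ((x - ℓ) / 2) * Real.cosh (x / 2) = (Real.cosh (x - ℓ / 2) + Real.cosh (ℓ / 2)) / 2 := by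
  have h1 : Real.cosh (x - ℓ / 2) = Real.cosh (x / 2 + (x - ℓ) / 2) := by ring_nf
  have h2 : Real.cosh (ℓ / 2) = Real.cosh (x / 2 - (x - ℓ) / 2) := by ring_nf
  rw [h1, h2, Real.cosh_add, Real.cosh_sub]
  ring

/-- The shifted self-overlap of `χ_a`: `∫ χ_a(x − ℓ)χ_a(x) dx = sinh(a − ℓ/2) + (2a − ℓ)·cosh(ℓ/2)/2` for `0 ≤ ℓ ≤ 2a`. -/
theorem integral_coshTest_shift_mul {ℓ : ℝ} (hℓ0 : 0 ≤ ℓ) (hℓ : ℓ ≤ 2 * a) :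
    ∫ x, (Icc (-a) a).indicator (fun y ↦ Real.cosh (y / 2)) (x - ℓ) * (Icc (-a) a).indicator (fun y ↦ Real.cosh (y / 2)) x
      = Real.sinh (a - ℓ / 2) + (2 * a - ℓ) * Real.cosh (ℓ / 2) / 2 := by
  set I := Icc (-a) a with hI
  set g : ℝ → ℝ := fun x ↦ (Real.cosh (x - ℓ / 2) + Real.cosh (ℓ / 2)) / 2 with hg
  have hprod : (fun x ↦ I.indicator (fun y ↦ Real.cosh (y / 2)) (x - ℓ) * I.indicator (fun y ↦ Real.cosh (y / 2)) x)
      = (Icc (ℓ - a) a).indicator g := by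
    ext x
    by_cases hx : x ∈ Icc (ℓ - a) a
    · have h1 : x ∈ I := ⟨by linarith [hx.1], hx.2⟩
      have h2 : x - ℓ ∈ I := ⟨by linarith [hx.1], by linarith [hx.2]⟩
      rw [indicator_of_mem hx, indicator_of_mem h1, indicator_of_mem h2, hg]
      exact cosh_half_mul_cosh_half x ℓ
    · rw [indicator_of_notMem hx]
      by_cases h1 : x ∈ I
      · have h2 : x - ℓ ∉ I := fun h2 ↦ hx ⟨by linarith [h2.1], h1.2⟩
        rw [indicator_of_notMem h2, zero_mul]
      · rw [indicator_of_notMem h1, mul_zero]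
  rw [hprod, MeasureTheory.integral_indicator measurableSet_Icc, integral_Icc_eq_integral_Ioc,
    ← intervalIntegral.integral_of_le (by linarith : ℓ - a ≤ a)]
  have hderiv : ∀ x ∈ uIcc (ℓ - a) a,
      HasDerivAt (fun x ↦ (Real.sinh (x - ℓ / 2) + x * Real.cosh (ℓ / 2)) / 2) (g x) x := by
    intro x _
    have h1 : HasDerivAt (fun x ↦ Real.sinh (x - ℓ / 2)) (Real.cosh (x - ℓ / 2)) x := by
      have := (Real.hasDerivAt_sinh (x - ℓ / 2)).comp x ((hasDerivAt_id x).sub_const (ℓ / 2))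
      simpa [Function.comp_def] using this
    have h2 : HasDerivAt (fun x ↦ x * Real.cosh (ℓ / 2)) (Real.cosh (ℓ / 2)) x := by
      simpa using (hasDerivAt_id x).mul_const (Real.cosh (ℓ / 2))
    have := (h1.add h2).div_const 2
    simpa [hg] using this
  have hcont : Continuous g := by
    simp only [hg]
    fun_prop
  rw [integral_eq_sub_of_hasDerivAt hderiv (hcont.intervalIntegrable _ _)]
  have hs : Real.sinh (ℓ - a - ℓ / 2) = -Real.sinh (a - ℓ / 2) := by
    rw [← Real.sinh_neg]; ring_nf
  rw [hs]
  ring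

/-- `∫ χ_a² = a + sinh a` (`a ≥ 0`). -/
theorem integral_coshTest_sq (ha : 0 ≤ a) :
    ∫ x, (Icc (-a) a).indicator (fun y ↦ Real.cosh (y / 2)) x ^ 2 = a + Real.sinh a := by
  have h := integral_coshTest_shift_mul (a := a) le_rfl (by linarith)
  simp only [sub_zero, zero_div, Real.cosh_zero, mul_one] at h
  rw [show (fun x ↦ (Icc (-a) a).indicator (fun y ↦ Real.cosh (y / 2)) x ^ 2)
      = fun x ↦ (Icc (-a) a).indicator (fun y ↦ Real.cosh (y / 2)) x
        * (Icc (-a) a).indicator (fun y ↦ Real.cosh (y / 2)) x from funext fun x ↦ pow_two _, h]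
  ring

/-- The test function is admissible: measurable, bounded by `cosh(a/2)`, vanishing off `[−a, a]`. -/
theorem coshTest_admissible (a : ℝ) :
    Measurable ((Icc (-a) a).indicator (fun y ↦ Real.cosh (y / 2)))
      ∧ (∀ x, |(Icc (-a) a).indicator (fun y ↦ Real.cosh (y / 2)) x| ≤ Real.cosh (a / 2))
      ∧ (∀ x, x ∉ Icc (-a) a → (Icc (-a) a).indicator (fun y ↦ Real.cosh (y / 2)) x = 0) := by
  refine ⟨(Real.continuous_cosh.measurable.comp (measurable_id.div_const 2)).indicator measurableSet_Icc,
    fun x ↦ ?_, fun x hx ↦ indicator_of_notMem hx _⟩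
  by_cases hx : x ∈ Icc (-a) a
  · rw [indicator_of_mem hx, abs_of_pos (Real.cosh_pos _), Real.cosh_le_cosh, abs_div, abs_div, abs_two]
    exact div_le_div_of_nonneg_right ((abs_le.2 ⟨hx.1, hx.2⟩).trans (le_abs_self a)) (by norm_num)
  · rw [indicator_of_notMem hx, abs_zero]; exact (Real.cosh_pos _).le

/-- Per-shift value on the Chebyshev side: for `n ≥ 1`, `ℓ = log n`,
`2Λ(n)/√n·(sinh(a − ℓ/2) + (2a − ℓ)cosh(ℓ/2)/2) = Λ(n)·(e^a/n − e^{−a} + (2a − log n)(1 + 1/n)/2)`. -/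
theorem shift_term_eq {n : ℕ} (hn : 1 ≤ n) (a : ℝ) :
    2 * ((Λ n : ℝ) / Real.sqrt n) * (Real.sinh (a - Real.log n / 2) + (2 * a - Real.log n) * Real.cosh (Real.log n / 2) / 2)
      = (Λ n : ℝ) * (Real.exp a / n - Real.exp (-a) + (2 * a - Real.log n) * (1 + 1 / n) / 2) := by
  have hn0 : (0 : ℝ) < n := by exact_mod_cast hn
  set s := Real.sqrt (n : ℝ) with hs
  have hs0 : 0 < s := Real.sqrt_pos.2 hn0
  have hss : s * s = n := Real.mul_self_sqrt hn0.le
  have hlog : Real.log n = 2 * Real.log s := by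
    rw [← hss, Real.log_mul hs0.ne' hs0.ne']; ring
  have h1 : Real.exp (a - Real.log n / 2) = Real.exp a / s := by
    rw [hlog, show a - 2 * Real.log s / 2 = a - Real.log s by ring, Real.exp_sub, Real.exp_log hs0]
  have h2 : Real.exp (-(a - Real.log n / 2)) = s * Real.exp (-a) := by
    rw [hlog, show -(a - 2 * Real.log s / 2) = Real.log s + -a by ring, Real.exp_add, Real.exp_log hs0]
  have h3 : Real.exp (Real.log n / 2) = s := by
    rw [hlog, show 2 * Real.log s / 2 = Real.log s by ring, Real.exp_log hs0]
  have h4 : Real.exp (-(Real.log n / 2)) = 1 / s := by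
    rw [Real.exp_neg, h3, one_div]
  rw [Real.sinh_eq, Real.cosh_eq, h1, h2, h3, h4, ← hss]
  field_simp

/-- **The Rayleigh numerator of `χ_a` in closed form on the Chebyshev side**:
`Q_a(χ_a) = Σ_{0 < n ≤ ⌊e^{2a}⌋} Λ(n)·(e^a/n − e^{−a} + (2a − log n)(1 + 1/n)/2)`. -/
theorem primeShiftForm_coshTest (a : ℝ) :
    primeShiftForm a ((Icc (-a) a).indicator (fun y ↦ Real.cosh (y / 2)))
      = ∑ n ∈ Finset.Ioc 0 ⌊Real.exp (2 * a)⌋₊,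
          (Λ n : ℝ) * (Real.exp a / n - Real.exp (-a) + (2 * a - Real.log n) * (1 + 1 / n) / 2) := by
  obtain ⟨-, -, hsupp⟩ := coshTest_admissible a
  set X := ⌊Real.exp (2 * a)⌋₊ with hX
  have hN : Real.exp (2 * a) ≤ ((X + 1 : ℕ) : ℝ) := by
    rw [hX]; push_cast; exact (Nat.lt_floor_add_one _).le
  rw [primeShiftForm_eq_sum_range hN hsupp]
  have hsub : Finset.Ioc 0 X ⊆ Finset.range (X + 1) := fun n hn ↦ by
    rw [Finset.mem_Ioc] at hn; rw [Finset.mem_range]; omega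
  rw [← Finset.sum_subset hsub fun n hn hn' ↦ by
    have h0 : n = 0 := by rw [Finset.mem_range] at hn; rw [Finset.mem_Ioc] at hn'; omega
    subst h0; simp]
  refine Finset.sum_congr rfl fun n hn ↦ ?_
  rw [Finset.mem_Ioc] at hn
  have hn1 : 1 ≤ n := hn.1
  have hn0 : (0 : ℝ) < n := by exact_mod_cast hn1
  have hlog0 : 0 ≤ Real.log n := Real.log_nonneg (by exact_mod_cast hn1)
  have hlog : Real.log n ≤ 2 * a := by
    rw [Real.log_le_iff_le_exp hn0]
    exact (Nat.cast_le.2 hn.2).trans (Nat.floor_le (Real.exp_pos _).le)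
  rw [integral_coshTest_shift_mul hlog0 hlog, shift_term_eq hn1]

/-! ## §2 Abel summation: `Σ_{n≤X} Λ(n) log(X/n) = ∫₁^X ψ(t) dt/t`, and its Chebyshev lower bound -/

/-- **`Σ_{n ≤ X} Λ(n)·(log X − log n) = ∫_{(1,X]} ψ(t)/t dt`** (Abel summation with `f(t) = log X − log t`; both sides vanish for `X < 1`). -/
theorem sum_vonMangoldt_mul_log_div_eq_integral (X : ℝ) :
    ∑ n ∈ Finset.Icc 0 ⌊X⌋₊, (Real.log X - Real.log n) * (Λ n : ℝ) = ∫ t in Ioc 1 X, t⁻¹ * ψ t := by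
  have hderiv : deriv (fun t : ℝ ↦ Real.log X - Real.log t) = fun t ↦ -t⁻¹ := by
    funext t
    rw [deriv_const_sub, Real.deriv_log]
  have hdiff : ∀ t ∈ Set.Icc 1 X, DifferentiableAt ℝ (fun t : ℝ ↦ Real.log X - Real.log t) t :=
    fun t ht ↦ (differentiableAt_const _).sub (Real.differentiableAt_log (by linarith [ht.1]))
  have hcont : ContinuousOn (fun t : ℝ ↦ -t⁻¹) (Set.Icc 1 X) :=
    (continuousOn_inv₀.mono fun t ht ↦ by simp only [mem_compl_iff, mem_singleton_iff]; linarith [ht.1]).neg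
  have hint : IntegrableOn (deriv (fun t : ℝ ↦ Real.log X - Real.log t)) (Set.Icc 1 X) := by
    rw [hderiv]; exact hcont.integrableOn_Icc
  have h := sum_mul_eq_sub_integral_mul₀ (fun k ↦ (Λ k : ℝ)) (by simp) X hdiff hint
  rw [h, sub_self, zero_mul, zero_sub, hderiv, ← MeasureTheory.integral_neg]
  refine setIntegral_congr_fun measurableSet_Ioc fun t _ ↦ ?_
  simp only [Chebyshev.psi_eq_sum_Icc]
  ring

/-- Integrability of `ψ(t)/t` on `(1, X]`. -/
theorem integrableOn_inv_mul_psi (X : ℝ) : IntegrableOn (fun t : ℝ ↦ t⁻¹ * ψ t) (Ioc 1 X) := by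
  have hcont : ContinuousOn (fun t : ℝ ↦ t⁻¹) (Set.Icc 1 X) :=
    continuousOn_inv₀.mono fun t ht ↦ by simp only [mem_compl_iff, mem_singleton_iff]; linarith [ht.1]
  have h := integrableOn_mul_sum_Icc (fun k ↦ (Λ k : ℝ)) (m := 0) zero_le_one hcont.integrableOn_Icc
  refine (h.mono_set Ioc_subset_Icc_self).congr_fun (fun t _ ↦ ?_) measurableSet_Ioc
  rw [Chebyshev.psi_eq_sum_Icc]

/-- Chebyshev from below in real form: `ψ(t) ≥ A·(t − 1) − 5·log t` for `t ≥ 30` (Literature `ChebyshevExplicit.psi_ge_chebyshev`). -/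
theorem psi_ge_cheb {t : ℝ} (ht : 30 ≤ t) :
    Literature.NumberTheory.LFunctions.ChebyshevExplicit.A * (t - 1) - 5 * Real.log t ≤ ψ t := by
  have hA := Literature.NumberTheory.LFunctions.ChebyshevExplicit.A_bounds
  have hfl : 30 ≤ ⌊t⌋₊ := Nat.le_floor (by exact_mod_cast ht)
  have h := Literature.NumberTheory.LFunctions.ChebyshevExplicit.psi_ge_chebyshev hfl
  rw [Chebyshev.psi_eq_psi_coe_floor t]
  have h1 : t - 1 ≤ (⌊t⌋₊ : ℝ) := (Nat.sub_one_lt_floor t).le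
  have h2 : Real.log (⌊t⌋₊ : ℝ) ≤ Real.log t :=
    Real.log_le_log (by exact_mod_cast (show 0 < ⌊t⌋₊ by omega)) (Nat.floor_le (by linarith))
  nlinarith [hA.1]

/-- **Chebyshev lower bound for `∫₁^X ψ(t)dt/t`**: `A·X − 30A − A·log X − (5/2)·log² X ≤ ∫_{(1,X]} ψ(t)/t dt` for `X ≥ 30`. -/
theorem integral_inv_mul_psi_ge {X : ℝ} (hX : 30 ≤ X) :
    Literature.NumberTheory.LFunctions.ChebyshevExplicit.A * X - 30 * Literature.NumberTheory.LFunctions.ChebyshevExplicit.A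
      - Literature.NumberTheory.LFunctions.ChebyshevExplicit.A * Real.log X - 5 / 2 * Real.log X ^ 2
      ≤ ∫ t in Ioc 1 X, t⁻¹ * ψ t := by
  set A := Literature.NumberTheory.LFunctions.ChebyshevExplicit.A with hAdef
  have hA := Literature.NumberTheory.LFunctions.ChebyshevExplicit.A_bounds
  -- restrict to `(30, X]` (the integrand is nonnegative)
  have hmono : ∫ t in Ioc 30 X, t⁻¹ * ψ t ≤ ∫ t in Ioc 1 X, t⁻¹ * ψ t :=
    setIntegral_mono_set (integrableOn_inv_mul_psi X)
      ((ae_restrict_iff' measurableSet_Ioc).2 (ae_of_all _ fun t ht ↦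
        mul_nonneg (inv_nonneg.2 (by linarith [ht.1])) (Chebyshev.psi_nonneg t)))
      (ae_of_all _ (Ioc_subset_Ioc_left (by norm_num)))
  refine le_trans ?_ hmono
  -- compare with `g` on `(30, X]` and integrate `g` exactly
  have hcontg : ContinuousOn (fun t : ℝ ↦ A - A * t⁻¹ - 5 * Real.log t * t⁻¹) (Set.Icc 30 X) := by
    have hinv : ContinuousOn (fun t : ℝ ↦ t⁻¹) (Set.Icc 30 X) :=
      continuousOn_inv₀.mono fun t ht ↦ by simp only [mem_compl_iff, mem_singleton_iff]; linarith [ht.1]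
    have hlog : ContinuousOn Real.log (Set.Icc 30 X) :=
      Real.continuousOn_log.mono fun t ht ↦ by simp only [mem_compl_iff, mem_singleton_iff]; linarith [ht.1]
    exact (continuousOn_const.sub (continuousOn_const.mul hinv)).sub ((continuousOn_const.mul hlog).mul hinv)
  have hle : ∫ t in Ioc 30 X, (A - A * t⁻¹ - 5 * Real.log t * t⁻¹) ≤ ∫ t in Ioc 30 X, t⁻¹ * ψ t := by
    refine setIntegral_mono_on (hcontg.integrableOn_Icc.mono_set Ioc_subset_Icc_self)
      ((integrableOn_inv_mul_psi X).mono_set (Ioc_subset_Ioc_left (by norm_num))) measurableSet_Ioc fun t ht ↦ ?_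
    have ht0 : 0 < t := by linarith [ht.1]
    have hψ := psi_ge_cheb (le_of_lt ht.1)
    rw [show A - A * t⁻¹ - 5 * Real.log t * t⁻¹ = t⁻¹ * (A * (t - 1) - 5 * Real.log t) by field_simp]
    exact mul_le_mul_of_nonneg_left hψ (inv_nonneg.2 ht0.le)
  refine le_trans ?_ hle
  -- `∫_{30}^{X} G' = G(X) − G(30)` with `G(t) = A t − A log t − (5/2) log² t`
  have hderiv : ∀ t ∈ uIcc 30 X, HasDerivAt (fun t : ℝ ↦ A * t - A * Real.log t - 5 / 2 * Real.log t ^ 2)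
      (A - A * t⁻¹ - 5 * Real.log t * t⁻¹) t := by
    intro t ht
    rw [uIcc_of_le hX] at ht
    have ht0 : t ≠ 0 := by linarith [ht.1]
    have hl : HasDerivAt Real.log t⁻¹ t := Real.hasDerivAt_log ht0
    have h1 : HasDerivAt (fun t : ℝ ↦ A * t) A t := by simpa using (hasDerivAt_id t).const_mul A
    have h2 : HasDerivAt (fun t : ℝ ↦ A * Real.log t) (A * t⁻¹) t := hl.const_mul A
    have h3 : HasDerivAt (fun t : ℝ ↦ 5 / 2 * Real.log t ^ 2) (5 / 2 * ((2 : ℕ) * Real.log t ^ (2 - 1) * t⁻¹)) t :=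
      (hl.pow 2).const_mul (5 / 2)
    refine ((h1.sub h2).sub h3).congr_deriv ?_
    rw [show (2 : ℕ) - 1 = 1 from rfl, pow_one]
    push_cast
    ring
  rw [← intervalIntegral.integral_of_le hX, integral_eq_sub_of_hasDerivAt hderiv
    ((hcontg.mono (by rw [uIcc_of_le hX])).intervalIntegrable)]
  have hl30 : 0 ≤ Real.log 30 := Real.log_nonneg (by norm_num)
  nlinarith [hA.1, sq_nonneg (Real.log 30), mul_nonneg (by linarith [hA.1] : 0 ≤ A) hl30]

/-! ## §3 The floor from below -/

/-- Mertens from below (Literature `MertensConstant.abs_mertensTau_le`): `log X − 4 ≤ M(X) = Σ_{0<n≤X} Λ(n)/n` for `X ≥ 1`. -/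
theorem vonMangoldt_div_sum_ge {X : ℝ} (hX : 1 ≤ X) :
    Real.log X - 4 ≤ ∑ n ∈ Finset.Ioc 0 ⌊X⌋₊, (Λ n : ℝ) / n := by
  have h := Literature.NumberTheory.LFunctions.Mertens.abs_mertensTau_le hX
  rw [Literature.NumberTheory.LFunctions.Mertens.mertensTau, Literature.NumberTheory.LFunctions.Mertens.primeLogDivSum, abs_le] at h
  have hsub : ∑ p ∈ Nat.primesLE ⌊X⌋₊, Real.log p / p ≤ ∑ n ∈ Finset.Ioc 0 ⌊X⌋₊, (Λ n : ℝ) / n := by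
    have heq : ∑ p ∈ Nat.primesLE ⌊X⌋₊, Real.log p / p = ∑ p ∈ Nat.primesLE ⌊X⌋₊, (Λ p : ℝ) / p :=
      Finset.sum_congr rfl fun p hp ↦ by rw [ArithmeticFunction.vonMangoldt_apply_prime (Nat.prime_of_mem_primesLE hp)]
    rw [heq]
    refine Finset.sum_le_sum_of_subset_of_nonneg (fun p hp ↦ ?_) fun n _ _ ↦
      div_nonneg ArithmeticFunction.vonMangoldt_nonneg (Nat.cast_nonneg _)
    have hpr := Nat.prime_of_mem_primesLE hp
    rw [Nat.mem_primesLE] at hp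
    rw [Finset.mem_Ioc]
    exact ⟨hpr.pos, hp.1⟩
  linarith [h.1]

/-- `e³ ≥ 20`, hence `e^a ≥ 20` and `e^a ≥ 20a − 40` for `a ≥ 3`. -/
theorem exp_ge_of_three_le (ha : 3 ≤ a) : 20 ≤ Real.exp a ∧ 20 * a - 40 ≤ Real.exp a := by
  have h1 := Real.exp_one_gt_d9
  have h3 : (20 : ℝ) ≤ Real.exp 3 := by
    rw [show (3 : ℝ) = 1 + 1 + 1 by norm_num, Real.exp_add, Real.exp_add]
    nlinarith [Real.exp_pos 1, mul_pos (Real.exp_pos 1) (Real.exp_pos 1)]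
  have hmono : Real.exp 3 ≤ Real.exp a := Real.exp_le_exp.2 ha
  have htan : (a - 3) + 1 ≤ Real.exp (a - 3) := Real.add_one_le_exp _
  have hsplit : Real.exp a = Real.exp 3 * Real.exp (a - 3) := by rw [← Real.exp_add]; ring_nf
  constructor
  · linarith
  · rw [hsplit]; nlinarith [Real.exp_pos (a - 3)]

/-- **The far-coercivity floor from below with Chebyshev's constant**: `(9/10)·e^a − 14 ≤ λ_max(a)` for every `a ≥ 3`
(Rayleigh quotient of `χ_a = 1_{[−a,a]}·cosh(·/2)`: `Q_a(χ_a) ≥ e^a(2a − 4) − e^{−a}ψ(e^{2a}) + ½∫₁^{e^{2a}}ψ(t)dt/t` over `∫χ_a² = a + sinh a`,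
with `ψ ≤ 1.106x + 3log²x + 80`, `∫ψ/t ≥ A x − 30A − A log x − (5/2)log²x`, `A ≥ 0.9212`, `M ≥ log x − 4`).  With `WeilFarFloorSchur`
(`λ_max(a) ≤ 1.106e^a + 12a² + 2a + 81`) the floor has exact exponential order with constants `[0.90, 1.106]`. -/
theorem farCoercivityFloor_ge_coshTest (ha : 3 ≤ a) : 9 / 10 * Real.exp a - 14 ≤ farCoercivityFloor a := by
  set A := Literature.NumberTheory.LFunctions.ChebyshevExplicit.A with hAdef
  have hA := Literature.NumberTheory.LFunctions.ChebyshevExplicit.A_bounds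
  obtain ⟨hm, hb, hs⟩ := coshTest_admissible a
  set χ := (Icc (-a) a).indicator (fun y ↦ Real.cosh (y / 2)) with hχ
  have ha0 : 0 ≤ a := by linarith
  obtain ⟨hE20, hElin⟩ := exp_ge_of_three_le ha
  set E := Real.exp a with hE
  have hEpos : 0 < E := Real.exp_pos a
  have hE2 : Real.exp (2 * a) = E ^ 2 := by rw [hE, ← Real.exp_nat_mul]; norm_num
  have hEinv : Real.exp (-a) * E = 1 := by rw [hE, ← Real.exp_add]; simp
  have hEinv0 : 0 < Real.exp (-a) := Real.exp_pos _
  have hEinv_le : Real.exp (-a) ≤ 1 / 20 := by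
    rw [le_div_iff₀ (by norm_num : (0:ℝ) < 20)]; nlinarith
  -- the norm
  have hnorm : ∫ x, χ x ^ 2 = a + Real.sinh a := integral_coshTest_sq ha0
  have hsinh : Real.sinh a ≤ E / 2 := by rw [Real.sinh_eq]; linarith
  have hsinh0 : 0 ≤ Real.sinh a := Real.sinh_nonneg_iff.2 ha0
  have hpos : 0 < ∫ x, χ x ^ 2 := by rw [hnorm]; linarith
  -- the quotient is in the floor's set
  have hle : primeShiftForm a χ / ∫ x, χ x ^ 2 ≤ farCoercivityFloor a :=
    le_csSup (primeShiftQuotients_bddAbove a) ⟨χ, Real.cosh (a / 2), hm, hb, hs, hpos, rfl⟩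
  refine le_trans ?_ hle
  rw [le_div_iff₀ hpos, hnorm, primeShiftForm_coshTest a]
  -- the three Chebyshev-side sums
  set X := ⌊Real.exp (2 * a)⌋₊ with hX
  have hX1 : 1 ≤ Real.exp (2 * a) := Real.one_le_exp (by linarith)
  have hX30 : 30 ≤ Real.exp (2 * a) := by rw [hE2]; nlinarith
  have hsplit : ∑ n ∈ Finset.Ioc 0 X, (Λ n : ℝ) * (E / n - Real.exp (-a) + (2 * a - Real.log n) * (1 + 1 / n) / 2)
      = E * (∑ n ∈ Finset.Ioc 0 X, (Λ n : ℝ) / n) - Real.exp (-a) * (∑ n ∈ Finset.Ioc 0 X, (Λ n : ℝ))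
        + ∑ n ∈ Finset.Ioc 0 X, (Λ n : ℝ) * ((2 * a - Real.log n) * (1 + 1 / n) / 2) := by
    rw [Finset.mul_sum, Finset.mul_sum, ← Finset.sum_sub_distrib, ← Finset.sum_add_distrib]
    refine Finset.sum_congr rfl fun n _ ↦ ?_
    ring
  rw [hsplit]
  -- (i) Mertens from below
  have hM : 2 * a - 4 ≤ ∑ n ∈ Finset.Ioc 0 X, (Λ n : ℝ) / n := by
    have h := vonMangoldt_div_sum_ge hX1
    rwa [Real.log_exp] at h
  -- (ii) Chebyshev from above for `ψ(e^{2a})`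
  have hψ : ∑ n ∈ Finset.Ioc 0 X, (Λ n : ℝ) ≤ 1106 / 1000 * E ^ 2 + 12 * a ^ 2 + 80 := by
    have hψX : ψ (Real.exp (2 * a)) = ∑ n ∈ Finset.Ioc 0 X, (Λ n : ℝ) := rfl
    rw [← hψX, Chebyshev.psi_eq_psi_coe_floor]
    have h := Literature.NumberTheory.LFunctions.ChebyshevExplicit.psi_le_chebyshev ⌊Real.exp (2 * a)⌋₊
    have hfl1 : (1 : ℝ) ≤ (⌊Real.exp (2 * a)⌋₊ : ℝ) := by exact_mod_cast Nat.le_floor (by exact_mod_cast hX1)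
    have hflX : (⌊Real.exp (2 * a)⌋₊ : ℝ) ≤ Real.exp (2 * a) := Nat.floor_le (by linarith)
    have hlog : Real.log (⌊Real.exp (2 * a)⌋₊ : ℝ) ≤ 2 * a := by
      have := Real.log_le_log (by linarith) hflX; rwa [Real.log_exp] at this
    have hlog0 : 0 ≤ Real.log (⌊Real.exp (2 * a)⌋₊ : ℝ) := Real.log_nonneg hfl1
    have hsq : Real.log (⌊Real.exp (2 * a)⌋₊ : ℝ) ^ 2 ≤ (2 * a) ^ 2 := pow_le_pow_left₀ hlog0 hlog 2
    have hmain : 6 / 5 * A * (⌊Real.exp (2 * a)⌋₊ : ℝ) ≤ 1106 / 1000 * E ^ 2 :=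
      (mul_le_mul_of_nonneg_right (by linarith [hA.2]) (by linarith)).trans
        (mul_le_mul_of_nonneg_left (hflX.trans hE2.le) (by norm_num))
    linarith
  -- (iii) the weighted sum via Abel + Chebyshev from below
  have hW : (A * E ^ 2 - 30 * A - A * (2 * a) - 5 / 2 * (2 * a) ^ 2) / 2
      ≤ ∑ n ∈ Finset.Ioc 0 X, (Λ n : ℝ) * ((2 * a - Real.log n) * (1 + 1 / n) / 2) := by
    have hI := integral_inv_mul_psi_ge hX30
    rw [← sum_vonMangoldt_mul_log_div_eq_integral, Real.log_exp, ← hX, hE2] at hI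
    have hdrop : ∑ n ∈ Finset.Icc 0 X, (2 * a - Real.log n) * (Λ n : ℝ)
        = ∑ n ∈ Finset.Ioc 0 X, (2 * a - Real.log n) * (Λ n : ℝ) := by
      rw [← Finset.sum_subset (Finset.Ioc_subset_Icc_self) fun n hn hn' ↦ by
        have h0 : n = 0 := by rw [Finset.mem_Icc] at hn; rw [Finset.mem_Ioc] at hn'; omega
        subst h0; simp]
    rw [hdrop] at hI
    have hterm : ∀ n ∈ Finset.Ioc 0 X, (2 * a - Real.log n) * (Λ n : ℝ) / 2
        ≤ (Λ n : ℝ) * ((2 * a - Real.log n) * (1 + 1 / n) / 2) := by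
      intro n hn
      rw [Finset.mem_Ioc] at hn
      have hn0 : (0 : ℝ) < n := by exact_mod_cast hn.1
      have hlog : Real.log n ≤ 2 * a := by
        rw [Real.log_le_iff_le_exp hn0]
        exact (Nat.cast_le.2 hn.2).trans (Nat.floor_le (Real.exp_pos _).le)
      have hΛ : 0 ≤ (Λ n : ℝ) := ArithmeticFunction.vonMangoldt_nonneg
      have h1n : 0 ≤ 1 / (n : ℝ) := by positivity
      nlinarith [mul_nonneg hΛ (mul_nonneg (by linarith : 0 ≤ 2 * a - Real.log n) h1n)]
    calc (A * E ^ 2 - 30 * A - A * (2 * a) - 5 / 2 * (2 * a) ^ 2) / 2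
        ≤ (∑ n ∈ Finset.Ioc 0 X, (2 * a - Real.log n) * (Λ n : ℝ)) / 2 := by linarith
      _ = ∑ n ∈ Finset.Ioc 0 X, (2 * a - Real.log n) * (Λ n : ℝ) / 2 := by rw [Finset.sum_div]
      _ ≤ _ := Finset.sum_le_sum hterm
  -- assemble: (9/10·E − 14)(a + sinh a) ≤ E·M − e^{−a}·ψ + W
  have hfac : 0 ≤ 9 / 10 * E - 14 := by linarith
  have hT : (9 / 10 * E - 14) * (a + Real.sinh a) ≤ (9 / 10 * E - 14) * (a + E / 2) :=
    mul_le_mul_of_nonneg_left (by linarith) hfac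
  refine hT.trans ?_
  have h1 : Real.exp (-a) * (1106 / 1000 * E ^ 2 + 12 * a ^ 2 + 80) ≤ 1106 / 1000 * E + (12 * a ^ 2 + 80) / 20 := by
    have : Real.exp (-a) * (1106 / 1000 * E ^ 2) = 1106 / 1000 * E := by
      calc Real.exp (-a) * (1106 / 1000 * E ^ 2) = 1106 / 1000 * E * (Real.exp (-a) * E) := by ring
        _ = 1106 / 1000 * E := by rw [hEinv, mul_one]
    nlinarith [mul_le_mul_of_nonneg_right hEinv_le (by positivity : (0 : ℝ) ≤ 12 * a ^ 2 + 80)]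
  have h2 : (11 / 10 * a + 1894 / 1000) * (20 * a - 40) ≤ (11 / 10 * a + 1894 / 1000) * E :=
    mul_le_mul_of_nonneg_left hElin (by linarith)
  have hMl : E * (2 * a - 4) ≤ E * ∑ n ∈ Finset.Ioc 0 X, (Λ n : ℝ) / n := mul_le_mul_of_nonneg_left hM hEpos.le
  have hψl : Real.exp (-a) * (∑ n ∈ Finset.Ioc 0 X, (Λ n : ℝ)) ≤ Real.exp (-a) * (1106 / 1000 * E ^ 2 + 12 * a ^ 2 + 80) :=
    mul_le_mul_of_nonneg_left hψ hEinv0.le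
  nlinarith [hMl, hψl, hW, h1, h2, hA.1, hA.2, sq_nonneg E, hE20]

end FloorCosh

end Summit.RiemannHypothesis.RiemannHypothesis.Theorems.WeilFormatC
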